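import Literature.NumberTheory.DiophantineGeometry.BertiniSmallDegreeCertificateProofs
import Literature.NumberTheory.DiophantineGeometry.PlaneSectionBadParameterCountProofs
import HarnessLib

/-!
# Counting the plane sections with a small factor (Cafure–Matera 2006, Thm. 3.3 / Cor. 3.4)

Library file (theorems only). Let `K = 𝔽_q` and `f ∈ K[x₀, …, xₙ]` (`n ≥ 1`) be absolutely
irreducible of total degree `δ`, and `1 ≤ D ≤ δ - 1`. Call a parameter
`(ν, ω, η) ∈ K^{n+1} × Kⁿ × Kⁿ` **`D`-bad** unless the plane section
`f_{ν,ω,η} = f(X + ν₀, ωᵢX + ηᵢY + ν_{i+1})` is non-constant and every divisor of its image in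
`K̄[x₀, x₁]` of total degree `≤ D` is a unit. We prove

* `smallFactor_fibre` (**Thm. 3.3 for the sections `planeSection f ν ω η`**): if Kaltofen's
  condition holds at `(ν, ω) ∈ K̄^{2n+1}` (the line restriction `f(X + ν₀, ωᵢX + νᵢ)` has degree `δ`
  and is separable), there is a nonzero `Ψ_D ∈ K̄[z₁, …, zₙ]` of degree `≤ δ (D+1)² 2Dδ` such that
  `Ψ_D(η) ≠ 0` implies that `planeSection f ν ω η` is non-constant and has no non-unit divisor of
  total degree `≤ D`. This is the tree's abstract certificate
  `BertiniSmallDegreeCertificateProofs.exists_noSmallFactor_certificate` (a variant of Kaltofen's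
  Thm. 5 for factors in the box `deg_X ≤ D`, `deg_Y ≤ D`) applied, exactly as in
  `Kaltofen1995.kaltofen1995_thm5_fibre`, to the section through the line `ν + X(1, ω)` with all
  `n + 1` coordinates sheared, followed by the elimination of the extra shear parameter
  (`exists_coeff_certificate`) and the transport `X ↦ X - γ₀Y` to `planeSection`
  (`transport_planeSection`); a divisor of total degree `≤ D` of the section pulls back to a
  divisor in the box because the shear does not raise the total degree
  (`totalDegree_equivMvPolynomial_algEquivAevalXAddC_le`).
* `card_filter_smallFactorBad_le` (**Cor. 3.4, counting form**): the number of `D`-bad parameters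
  in `K^{n+1} × Kⁿ × Kⁿ` is at most `(2δ² + δ (D+1)² 2Dδ) q^{3n}` — the zeros of Kaltofen's `Υ`
  (`deg Υ ≤ 2δ²`, `kaltofen1995_lemma4`) contribute `≤ 2δ² q^{2n} · qⁿ`, and over each good `(ν, ω)`
  the zeros of `Ψ_D` in `Kⁿ ⊆ K̄ⁿ` contribute `≤ deg Ψ_D · q^{n-1}` (Schwartz–Zippel, Lemma 2.1).
  (Printed: `(D³δ² - … + 2δ²) q^{3n-3}` for the `q^{3n-2}` parametrisations of type (10) in the
  paper's indexing; here the cruder degree bound of the tree's certificate.)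

## References

* A. Cafure, G. Matera, *Improved explicit estimates on the number of solutions of equations over
  a finite field*, Finite Fields Appl. 12 (2006) 155–185, Lemma 2.1, §3.2, Thm. 3.3, Cor. 3.4.
  [CafureMatera2006]
* E. Kaltofen, *Effective Noether irreducibility forms and applications*, J. Comput. System Sci.
  50 (1995) 274–295, §4 Lemma 4, Thm. 5. [Kaltofen1995]
-/

noncomputable section

open scoped Classical
open MvPolynomial Literature.RingTheory.MvPolynomial Polynomial.Bivariate

namespace Literature.NumberTheory.DiophantineGeometry

universe u

/-! ### Total degree and the shear `X ↦ X + aY` -/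

section Transport

variable {E : Type*} [Field E]

/-- A nonzero non-unit polynomial over a field has positive total degree. [folklore] -/
private theorem totalDegree_pos_of_ne_zero_of_not_isUnit {σ : Type*} {P : MvPolynomial σ E}
    (hP0 : P ≠ 0) (hPu : ¬ IsUnit P) : 0 < P.totalDegree := by
  by_contra h
  rw [not_lt, Nat.le_zero, totalDegree_eq_zero_iff_eq_C] at h
  apply hPu
  rw [h]
  refine (IsUnit.mk0 _ fun h0 ↦ hP0 ?_).map MvPolynomial.C
  rw [h, h0, MvPolynomial.C_0]

/-- **The shear of the outer variable by a multiple of the inner one does not raise the total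
degree**: for `R ∈ E[Y][X]` and `a ∈ E`,
`deg R(X + aY, Y) ≤ deg R` (total degrees read through `Polynomial.Bivariate.equivMvPolynomial`).
[folklore] -/
theorem totalDegree_equivMvPolynomial_algEquivAevalXAddC_le (a : E) (R : Polynomial (Polynomial E)) :
    (equivMvPolynomial E (Polynomial.algEquivAevalXAddC (Polynomial.C a * Polynomial.X) R)).totalDegree ≤
      (equivMvPolynomial E R).totalDegree := by
  set θ : Fin 2 → MvPolynomial (Fin 2) E :=
    Fin.cons (MvPolynomial.X 0) fun _ ↦ MvPolynomial.X 1 + MvPolynomial.C a * MvPolynomial.X 0 with hθ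
  -- the two ring homomorphisms `E[Y][X] → E[x₀, x₁]` agree
  have key : ((equivMvPolynomial E : Polynomial (Polynomial E) ≃ₐ[E] MvPolynomial (Fin 2) E) :
        Polynomial (Polynomial E) →+* MvPolynomial (Fin 2) E).comp
      (Polynomial.algEquivAevalXAddC (Polynomial.C a * Polynomial.X) :
        Polynomial (Polynomial E) →+* Polynomial (Polynomial E)) =
      (MvPolynomial.aeval θ).toRingHom.comp
        (equivMvPolynomial E : Polynomial (Polynomial E) →+* MvPolynomial (Fin 2) E) := by
    refine Polynomial.ringHom_ext (fun p ↦ ?_) ?_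
    · -- constants in `X`: polynomials in `Y`
      refine Polynomial.induction_on' p (fun p₁ p₂ h₁ h₂ ↦ ?_) (fun k e ↦ ?_)
      · rw [Polynomial.C_add, map_add, map_add, h₁, h₂]
      · rw [← Polynomial.C_mul_X_pow_eq_monomial, RingHom.comp_apply, RingHom.comp_apply]
        simp only [RingHom.coe_coe, AlgHom.toRingHom_eq_coe, Polynomial.algEquivAevalXAddC_apply,
          Polynomial.aeval_C, Polynomial.algebraMap_eq, map_mul, map_pow,
          equivMvPolynomial_C_C, equivMvPolynomial_C_X, MvPolynomial.aeval_C, MvPolynomial.aeval_X,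
          MvPolynomial.algebraMap_eq, hθ, Fin.cons_zero]
    · rw [RingHom.comp_apply, RingHom.comp_apply]
      simp only [RingHom.coe_coe, AlgHom.toRingHom_eq_coe, Polynomial.algEquivAevalXAddC_apply,
        Polynomial.aeval_X, map_add, map_mul, equivMvPolynomial_X, equivMvPolynomial_C_C,
        equivMvPolynomial_C_X, MvPolynomial.aeval_X, hθ, Fin.cons_one]
  have h := congrArg (fun φ : Polynomial (Polynomial E) →+* MvPolynomial (Fin 2) E ↦ φ R) key
  simp only [RingHom.comp_apply, RingHom.coe_coe, AlgHom.toRingHom_eq_coe] at h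
  rw [h]
  refine totalDegree_aeval_le_of_le_one θ (fun i ↦ ?_) _
  refine Fin.cases ?_ (fun j ↦ ?_) i
  · rw [hθ, Fin.cons_zero]; exact (totalDegree_X (R := E) _).le
  · rw [hθ, Fin.cons_succ]
    refine (totalDegree_add _ _).trans (max_le (totalDegree_X (R := E) _).le ?_)
    refine (totalDegree_mul _ _).trans ?_
    rw [totalDegree_C, zero_add]
    exact (totalDegree_X (R := E) _).le

end Transport

/-! ### Theorem 3.3 for the sections `planeSection f ν ω η` -/

section Fibre

open Polynomial Kaltofen1995
open Literature.RingTheory.NoetherNormalization (linearChange linearChangeEquiv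
  linearChangeEquiv_apply)

/-- **Cafure–Matera's Theorem 3.3 for the sections `planeSection f ν ω η`.** Let
`f ∈ K[x₀, …, xₙ]` be absolutely irreducible of total degree `δ`, `D + 1 ≤ δ`, and let
`(ν, ω) ∈ K̄^{n+1} × K̄ⁿ` be such that the line restriction `f(X + ν₀, ω₁X + ν₁, …)` has degree `δ`
and is separable (Kaltofen's condition (33)). Then some nonzero `Ψ ∈ K̄[z₁, …, zₙ]` with
`deg Ψ ≤ δ (D+1)² 2Dδ` has the property: if `Ψ(η) ≠ 0` then
`planeSection f ν ω η = f(X + ν₀, ωᵢX + ηᵢY + νᵢ) ∈ K̄[X, Y]` is non-constant and every divisor of it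
of total degree `≤ D` is a unit. Proof: the certificate `exists_noSmallFactor_certificate` of the
section through the line `ν + X(1, ω)` with all coordinates sheared, the elimination of the shear
parameter `z₀` (`exists_coeff_certificate`) and the transport `X ↦ X - γ₀Y`
(`transport_planeSection`), under which a divisor of total degree `≤ D` becomes a divisor in the
box `deg_X ≤ D`, `deg_Y ≤ D` of positive `X`-degree. [cite: CafureMatera2006, Thm. 3.3]
[cite: Kaltofen1995, §4 Thm. 5] -/
theorem smallFactor_fibre (K : Type u) [Field K] {n δ D : ℕ}
    (f : MvPolynomial (Fin (n + 1)) K) (hDδ : D + 1 ≤ δ) (hdeg : f.totalDegree = δ)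
    (hf : IsAbsIrreducible f) (ν : Fin (n + 1) → AlgebraicClosure K) (ω : Fin n → AlgebraicClosure K)
    (hgdeg : (lineRestrict f ν ω).natDegree = δ) (hgsep : (lineRestrict f ν ω).Separable) :
    ∃ Ψ : MvPolynomial (Fin n) (AlgebraicClosure K), Ψ ≠ 0 ∧
      Ψ.totalDegree ≤ δ * ((D + 1) ^ 2 * (2 * D * δ)) ∧
        ∀ η : Fin n → AlgebraicClosure K, MvPolynomial.eval η Ψ ≠ 0 →
          (0 < (planeSection f ν ω η).totalDegree ∧
            ∀ H : MvPolynomial (Fin 2) (AlgebraicClosure K), H ∣ planeSection f ν ω η →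
              H.totalDegree ≤ D → IsUnit H) := by
  have hδ : 1 ≤ δ := le_trans (Nat.succ_le_succ (Nat.zero_le D)) hDδ
  set fb : MvPolynomial (Fin (n + 1)) (AlgebraicClosure K) := MvPolynomial.map (algebraMap K (AlgebraicClosure K)) f with hfb'
  have hfb : Irreducible fb := hf
  have hdegb : fb.totalDegree = δ := by
    rw [hfb', totalDegree_map_of_injective f (algebraMap K (AlgebraicClosure K)).injective, hdeg]
  set g : (AlgebraicClosure K)[X] := lineRestrict f ν ω with hg
  have hgb : MvPolynomial.aeval (fun i => Polynomial.C (ν i) +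
      Polynomial.C ((Fin.cons 1 ω : Fin (n + 1) → (AlgebraicClosure K)) i) * Polynomial.X) fb = g := by
    rw [hg, ← lineRestrict_map (K' := (AlgebraicClosure K)) f ν ω]; rfl
  have hg0 : g ≠ 0 := fun h0 => by rw [h0, natDegree_zero] at hgdeg; omega
  set c : (AlgebraicClosure K) := g.coeff δ with hc
  have hc0 : c ≠ 0 := by
    rw [hc, ← hgdeg, Polynomial.coeff_natDegree]; exact leadingCoeff_ne_zero.2 hg0
  have hc' : MvPolynomial.eval (Fin.cons 1 ω : Fin (n + 1) → (AlgebraicClosure K))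
      (MvPolynomial.homogeneousComponent δ fb) = c := by
    rw [hc, hg, ← lineRestrict_map (K' := (AlgebraicClosure K)) f ν ω, ← hfb', ← hdegb, coeff_lineRestrict_totalDegree]
    rfl
  -- the plane section with all `n + 1` coordinates sheared
  set χ : Polynomial (Polynomial (MvPolynomial (Fin (n + 1)) (AlgebraicClosure K))) :=
    MvPolynomial.aeval (fun i =>
      (Polynomial.C (Polynomial.C (MvPolynomial.C (ν i))) +
        Polynomial.C (Polynomial.C (MvPolynomial.C
          ((Fin.cons 1 ω : Fin (n + 1) → (AlgebraicClosure K)) i))) * Polynomial.X +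
        Polynomial.C (Polynomial.C (MvPolynomial.X i) * Polynomial.X) :
          Polynomial (Polynomial (MvPolynomial (Fin (n + 1)) (AlgebraicClosure K))))) fb with hχ
  have hcoeff : χ.coeff δ = Polynomial.C (MvPolynomial.C c) := by
    rw [hχ, ← hdegb, coeff_planeSubst_totalDegree, hdegb, hc']
  have hχdeg : χ.natDegree = δ := by
    refine le_antisymm ?_ (le_natDegree_of_ne_zero ?_)
    · rw [hχ, ← hdegb]; exact natDegree_planeSubst_le fb ν _
    · rw [hcoeff]
      exact Polynomial.C_ne_zero.2 (MvPolynomial.C_ne_zero.2 hc0)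
  have hlead : χ.leadingCoeff = Polynomial.C (MvPolynomial.C c) := by
    rw [Polynomial.leadingCoeff, hχdeg, hcoeff]
  have hirr : Irreducible χ := by
    rw [hχ]
    exact irreducible_planeSubst hfb ν _ (by rw [hgb]; exact hg0)
  have htd : ∀ e j, δ < j + e → (χ.coeff e).coeff j = 0 := by
    rw [hχ, ← hdegb]; exact coeff_coeff_planeSubst_eq_zero fb ν _
  have hfil : ∀ e j, ((χ.coeff e).coeff j).totalDegree ≤ j := by
    rw [hχ]; exact filtration_planeSubst fb ν _
  have hred : χ.map (evalRingHom 0) =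
      g.map (MvPolynomial.C : (AlgebraicClosure K) →+* MvPolynomial (Fin (n + 1)) (AlgebraicClosure K)) := by
    rw [hχ, map_evalRingHom_zero_planeSubst, hgb]
  -- Cafure–Matera's certificate for the sheared section
  obtain ⟨Ψ', hΨ'0, hΨ'deg, hΨ'⟩ := exists_noSmallFactor_certificate (n := n + 1) hDδ hχdeg
    hc0 hlead hirr htd hfil hred hgsep
  -- remove the shear: `Ψ''(z₀, z) = Ψ'(z₀, z + ω z₀)`, `Ψ` its leading `z₀`-coefficient
  set Ψ'' := linearChange ω Ψ' with hΨ''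
  have hΨ''0 : Ψ'' ≠ 0 := by
    rw [hΨ'', ← linearChangeEquiv_apply]
    exact (EmbeddingLike.map_ne_zero_iff).2 hΨ'0
  obtain ⟨Ψ, hΨ0, hΨdeg, hΨ⟩ := exists_coeff_certificate hΨ''0
  refine ⟨Ψ, hΨ0, ?_, fun η hη => ?_⟩
  · have := totalDegree_linearChange_le ω Ψ'
    rw [← hΨ''] at this
    omega
  obtain ⟨γ₀, hγ₀⟩ := hΨ η hη
  rw [hΨ'', eval_linearChange] at hγ₀
  simp only [Fin.cons_zero, Fin.cons_succ] at hγ₀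
  set γ : Fin (n + 1) → (AlgebraicClosure K) := Fin.cons γ₀ fun i => η i + ω i * γ₀ with hγ
  have hcert := hΨ' γ hγ₀
  -- the specialised sheared section `χ₀` and its transport to `planeSection f ν ω η`
  set χ₀ : Polynomial (Polynomial (AlgebraicClosure K)) := χ.map (mapRingHom (MvPolynomial.eval γ)) with hχ₀
  set S : Polynomial (Polynomial (AlgebraicClosure K)) ≃ₐ[Polynomial (AlgebraicClosure K)] Polynomial (Polynomial (AlgebraicClosure K)) :=
    Polynomial.algEquivAevalXAddC (-(Polynomial.C γ₀ * Polynomial.X) : (AlgebraicClosure K)[X]) with hSdef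
  set ε : Polynomial (Polynomial (AlgebraicClosure K)) ≃ₐ[(AlgebraicClosure K)] MvPolynomial (Fin 2) (AlgebraicClosure K) :=
    (equivMvPolynomial (AlgebraicClosure K)).trans (MvPolynomial.renameEquiv (AlgebraicClosure K) (Equiv.swap (0 : Fin 2) 1)) with hεdef
  have hF : ε (S χ₀) = planeSection f ν ω η := transport_planeSection f ν ω η γ₀
  -- `χ₀` has `X`-degree `δ` and constant leading coefficient
  have hlc : (mapRingHom (MvPolynomial.eval γ)) χ.leadingCoeff = Polynomial.C c := by
    rw [hlead, coe_mapRingHom, Polynomial.map_C, MvPolynomial.eval_C]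
  have hlc0 : (mapRingHom (MvPolynomial.eval γ)) χ.leadingCoeff ≠ 0 := by
    rw [hlc]; exact Polynomial.C_ne_zero.2 hc0
  have hdeg0 : χ₀.natDegree = δ := by
    rw [hχ₀, natDegree_map_of_leadingCoeff_ne_zero _ hlc0, hχdeg]
  have hlead0 : χ₀.leadingCoeff = Polynomial.C c := by
    rw [hχ₀, leadingCoeff_map_of_leadingCoeff_ne_zero _ hlc0, hlc]
  have hχ₀0 : χ₀ ≠ 0 := fun h0 => by rw [h0, natDegree_zero] at hdeg0; omega
  have hχ₀u : ¬ IsUnit χ₀ := fun hu => by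
    have := natDegree_eq_zero_of_isUnit hu
    omega
  rw [← hF]
  refine ⟨?_, fun H hH hHD => ?_⟩
  · -- non-constant
    refine totalDegree_pos_of_ne_zero_of_not_isUnit ?_ fun hu => hχ₀u ?_
    · exact (EmbeddingLike.map_ne_zero_iff).2 ((EmbeddingLike.map_ne_zero_iff).2 hχ₀0)
    · exact (isUnit_map_iff S _).1 ((isUnit_map_iff ε _).1 hu)
  · -- a divisor of total degree `≤ D` pulls back to a box-small divisor of `χ₀`
    by_contra hHu
    set P₁ : Polynomial (Polynomial (AlgebraicClosure K)) := ε.symm H with hP₁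
    set P : Polynomial (Polynomial (AlgebraicClosure K)) := S.symm P₁ with hP
    have hPH : ε (S P) = H := by rw [hP, hP₁, AlgEquiv.apply_symm_apply, AlgEquiv.apply_symm_apply]
    have hPdvd : P ∣ χ₀ := by
      have h1 : ε (S P) ∣ ε (S χ₀) := by rw [hPH]; exact hH
      exact (map_dvd_iff S).1 ((map_dvd_iff ε).1 h1)
    obtain ⟨Q, hPQ⟩ := hPdvd
    have hPu : ¬ IsUnit P := fun hu => hHu (by rw [← hPH]; exact (hu.map S).map ε)
    have hP0 : P ≠ 0 := fun h0 => hχ₀0 (by rw [hPQ, h0, zero_mul])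
    -- total degree of `P` (through `equivMvPolynomial`) is at most `D`
    have hTP : (equivMvPolynomial (AlgebraicClosure K) P).totalDegree ≤ D := by
      have h1 : (equivMvPolynomial (AlgebraicClosure K) P).totalDegree ≤ (equivMvPolynomial (AlgebraicClosure K) P₁).totalDegree := by
        have hS' : P = Polynomial.algEquivAevalXAddC (Polynomial.C γ₀ * Polynomial.X) P₁ := by
          rw [hP, hSdef, Polynomial.algEquivAevalXAddC_symm, neg_neg]
        rw [hS']
        exact totalDegree_equivMvPolynomial_algEquivAevalXAddC_le γ₀ P₁
      have h2 : equivMvPolynomial (AlgebraicClosure K) P₁ = MvPolynomial.rename (Equiv.swap (0 : Fin 2) 1) H := by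
        rw [hP₁, hεdef, AlgEquiv.symm_trans_apply, AlgEquiv.apply_symm_apply,
          MvPolynomial.renameEquiv_symm, Equiv.symm_swap, MvPolynomial.renameEquiv_apply]
      have h3 : (MvPolynomial.rename (Equiv.swap (0 : Fin 2) 1) H).totalDegree ≤ H.totalDegree :=
        totalDegree_rename_le _ _
      rw [h2] at h1
      omega
    -- the box conditions
    have hnat : P.natDegree ≤ D :=
      (le_totalDegree_equivMvPolynomial_of_coeff_ne_zero P
        (by rw [Polynomial.coeff_natDegree]; exact leadingCoeff_ne_zero.2 hP0)).trans hTP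
    have hcoef : ∀ e, (P.coeff e).natDegree ≤ D := fun e =>
      (natDegree_coeff_le_totalDegree_sub P e).trans ((Nat.sub_le _ _).trans hTP)
    have h1 : 1 ≤ P.natDegree := by
      by_contra h
      rw [not_le, Nat.lt_one_iff] at h
      apply hPu
      have hl := congrArg Polynomial.leadingCoeff hPQ
      rw [hlead0, Polynomial.leadingCoeff_mul, Polynomial.leadingCoeff, h] at hl
      rw [Polynomial.eq_C_of_natDegree_eq_zero h]
      refine Polynomial.isUnit_C.2 (isUnit_of_dvd_unit ⟨Q.leadingCoeff, hl⟩ ?_)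
      exact Polynomial.isUnit_C.2 (IsUnit.mk0 c hc0)
    exact hcert P Q hPQ h1 hnat hcoef

end Fibre

/-! ### Corollary 3.4: counting the `D`-bad parameters -/

section Count

open Kaltofen1995

variable {K : Type u} [Field K] [Fintype K]

/-- **Cafure–Matera (2006), Corollary 3.4 (counting form, for the sections `planeSection`).** Let
`K = 𝔽_q`, `f ∈ K[x₀, …, xₙ]` (`n ≥ 1`) absolutely irreducible of total degree `δ`, and
`D + 1 ≤ δ`. The number of parameters `(ν, ω, η) ∈ K^{n+1} × Kⁿ × Kⁿ` that are `D`-bad — the plane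
section `f_{ν,ω,η}` is constant, or its image in `K̄[x₀, x₁]` has a non-unit divisor of total
degree `≤ D` — is at most `(2δ² + δ (D+1)² 2Dδ) q^{3n}`: the zeros of Kaltofen's `Υ`
(`kaltofen1995_lemma4`) and, fibre by fibre over the other `(ν, ω)`, the zeros of the certificate
`Ψ_D` of `smallFactor_fibre`, counted by Schwartz–Zippel (Lemma 2.1).
[cite: CafureMatera2006, Cor. 3.4] [cite: Kaltofen1995, §4 Lemma 4] -/
theorem card_filter_smallFactorBad_le {n : ℕ} (hn : 1 ≤ n) (f : MvPolynomial (Fin (n + 1)) K)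
    {δ D : ℕ} (hdeg : f.totalDegree = δ) (hf : IsAbsIrreducible f) (hDδ : D + 1 ≤ δ) :
    ((Finset.univ : Finset ((Fin (n + 1) → K) × (Fin n → K) × (Fin n → K))).filter fun p ↦
        ¬ (0 < (planeSection f p.1 p.2.1 p.2.2).totalDegree ∧
            ∀ H : MvPolynomial (Fin 2) (AlgebraicClosure K),
              H ∣ MvPolynomial.map (algebraMap K (AlgebraicClosure K))
                  (planeSection f p.1 p.2.1 p.2.2) →
                H.totalDegree ≤ D → IsUnit H)).card ≤
      (2 * δ ^ 2 + δ * ((D + 1) ^ 2 * (2 * D * δ))) * Fintype.card K ^ (3 * n) := by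
  set Kb := AlgebraicClosure K
  set ι : K →+* Kb := algebraMap K Kb with hι
  set q : ℕ := Fintype.card K with hq
  set e' : ℕ := δ * ((D + 1) ^ 2 * (2 * D * δ)) with he'
  have hδ : 0 < δ := by omega
  obtain ⟨Υ, hΥ0, hΥdeg, hΥ⟩ := kaltofen1995_lemma4 K n δ f hδ hdeg hf
  -- the bad parameters
  set bad : (Fin (n + 1) → K) × (Fin n → K) × (Fin n → K) → Prop := fun p ↦
    ¬ (0 < (planeSection f p.1 p.2.1 p.2.2).totalDegree ∧
        ∀ H : MvPolynomial (Fin 2) Kb,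
          H ∣ MvPolynomial.map ι (planeSection f p.1 p.2.1 p.2.2) →
            H.totalDegree ≤ D → IsUnit H) with hbad
  -- `Υ(ν, ω)` read over `K̄` is the image of `Υ(ν, ω)` read over `K`
  have hΥeval : ∀ (ν : Fin (n + 1) → K) (ω : Fin n → K),
      MvPolynomial.aeval (Sum.elim (ι ∘ ν) (ι ∘ ω)) Υ = ι (MvPolynomial.eval (Sum.elim ν ω) Υ) := by
    intro ν ω
    have h := MvPolynomial.eval₂_comp_left ι (RingHom.id K) (Sum.elim ν ω) Υ
    rw [RingHom.comp_id] at h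
    rw [← Sum.comp_elim, MvPolynomial.aeval_def]
    exact h.symm
  -- the fibre count `b(ν, ω) = #{η : (ν, ω, η) bad}`
  set b : (Fin (n + 1) → K) × (Fin n → K) → ℕ := fun νω ↦
    ((Finset.univ : Finset (Fin n → K)).filter fun η ↦ bad (νω.1, νω.2, η)).card with hb
  have hL : ((Finset.univ : Finset ((Fin (n + 1) → K) × (Fin n → K) × (Fin n → K))).filter
      bad).card = ∑ ν : Fin (n + 1) → K, ∑ ω : Fin n → K, ∑ η : Fin n → K,
        (if bad (ν, ω, η) then 1 else 0) := by
    rw [Finset.card_filter, Fintype.sum_prod_type]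
    refine Finset.sum_congr rfl fun ν _ ↦ ?_
    rw [Fintype.sum_prod_type]
  have hR : ∑ νω : (Fin (n + 1) → K) × (Fin n → K), b νω =
      ∑ ν : Fin (n + 1) → K, ∑ ω : Fin n → K, ∑ η : Fin n → K, (if bad (ν, ω, η) then 1 else 0) := by
    rw [Fintype.sum_prod_type]
    refine Finset.sum_congr rfl fun ν _ ↦ Finset.sum_congr rfl fun ω _ ↦ ?_
    rw [hb]
    beta_reduce
    rw [Finset.card_filter]
  have hcardB : ((Finset.univ : Finset ((Fin (n + 1) → K) × (Fin n → K) × (Fin n → K))).filter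
      bad).card = ∑ νω : (Fin (n + 1) → K) × (Fin n → K), b νω := hL.trans hR.symm
  -- fibres over the zeros of `Υ`: trivial bound
  have hb_triv : ∀ νω, b νω ≤ q ^ n := fun νω ↦ by
    rw [hb]
    exact (Finset.card_filter_le _ _).trans (by rw [Finset.card_univ, Fintype.card_fun, Fintype.card_fin])
  -- fibres off the zeros of `Υ`: the certificate `Ψ_D`
  have hb_good : ∀ νω : (Fin (n + 1) → K) × (Fin n → K),
      MvPolynomial.eval (Sum.elim νω.1 νω.2) Υ ≠ 0 → b νω ≤ e' * q ^ (n - 1) := by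
    rintro ⟨ν, ω⟩ hne
    have hne' : MvPolynomial.aeval (Sum.elim (ι ∘ ν) (ι ∘ ω)) Υ ≠ 0 := by
      rw [hΥeval, map_ne_zero_iff ι ι.injective]; exact hne
    obtain ⟨hgdeg, hgsep⟩ := hΥ (ι ∘ ν) (ι ∘ ω) hne'
    obtain ⟨Ψ, hΨ0, hΨdeg, hΨ⟩ := smallFactor_fibre K f hDδ hdeg hf (ι ∘ ν) (ι ∘ ω) hgdeg hgsep
    have hsub : ((Finset.univ : Finset (Fin n → K)).filter fun η ↦ bad (ν, ω, η)) ⊆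
        (Finset.univ.filter fun η ↦ MvPolynomial.eval (ι ∘ η) Ψ = 0) := by
      intro η hη
      rw [Finset.mem_filter] at hη ⊢
      refine ⟨Finset.mem_univ _, ?_⟩
      by_contra hΨη
      apply hη.2
      obtain ⟨hpos, hdiv⟩ := hΨ (ι ∘ η) hΨη
      have hmap : MvPolynomial.map ι (planeSection f ν ω η) =
          planeSection f (ι ∘ ν) (ι ∘ ω) (ι ∘ η) := map_planeSection f ν ω η
      refine ⟨?_, fun H hH hHD ↦ hdiv H (by rw [← hmap]; exact hH) hHD⟩
      rw [← totalDegree_map_of_injective (planeSection f ν ω η) ι.injective, hmap]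
      exact hpos
    calc b (ν, ω) ≤ (Finset.univ.filter fun η : Fin n → K ↦ MvPolynomial.eval (ι ∘ η) Ψ = 0).card :=
          Finset.card_le_card hsub
      _ ≤ Ψ.totalDegree * q ^ (n - 1) := card_filter_eval_comp_eq_zero_le hn hΨ0
      _ ≤ e' * q ^ (n - 1) := Nat.mul_le_mul_right _ hΨdeg
  -- ### summation
  set U₀ : Finset ((Fin (n + 1) → K) × (Fin n → K)) :=
    Finset.univ.filter fun νω ↦ MvPolynomial.eval (Sum.elim νω.1 νω.2) Υ = 0 with hU₀
  have hU₀card : U₀.card ≤ 2 * δ ^ 2 * q ^ (2 * n) :=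
    (card_filter_eval_sumElim_eq_zero_le hΥ0).trans (Nat.mul_le_mul_right _ hΥdeg)
  have hUcard : (Finset.univ : Finset ((Fin (n + 1) → K) × (Fin n → K))).card = q ^ (2 * n + 1) := by
    rw [Finset.card_univ, Fintype.card_prod, Fintype.card_fun, Fintype.card_fun, Fintype.card_fin,
      Fintype.card_fin, ← pow_add]
    congr 1; omega
  have hsum : ∑ νω : (Fin (n + 1) → K) × (Fin n → K), b νω ≤
      U₀.card * q ^ n + (Finset.univ : Finset ((Fin (n + 1) → K) × (Fin n → K))).card *
        (e' * q ^ (n - 1)) := by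
    rw [← Finset.sum_filter_add_sum_filter_not Finset.univ (fun νω ↦ νω ∈ U₀)]
    refine add_le_add ?_ ?_
    · have h1 : (Finset.univ.filter fun νω : (Fin (n + 1) → K) × (Fin n → K) ↦ νω ∈ U₀) = U₀ := by
        ext νω; simp
      rw [h1]
      exact Finset.sum_le_card_nsmul _ _ _ (fun νω _ ↦ hb_triv νω) |>.trans (by rw [smul_eq_mul])
    · calc ∑ νω ∈ Finset.univ.filter (fun νω : (Fin (n + 1) → K) × (Fin n → K) ↦ νω ∉ U₀), b νω
          ≤ (Finset.univ.filter fun νω : (Fin (n + 1) → K) × (Fin n → K) ↦ νω ∉ U₀).card •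
              (e' * q ^ (n - 1)) := by
            refine Finset.sum_le_card_nsmul _ _ _ fun νω hνω ↦ hb_good νω ?_
            rw [Finset.mem_filter] at hνω
            intro h0
            exact hνω.2 (Finset.mem_filter.2 ⟨Finset.mem_univ _, h0⟩)
        _ ≤ (Finset.univ : Finset ((Fin (n + 1) → K) × (Fin n → K))).card • (e' * q ^ (n - 1)) :=
            nsmul_le_nsmul_left (Nat.zero_le _) (Finset.card_filter_le _ _)
        _ = _ := smul_eq_mul _ _
  -- conclusion
  change (Finset.univ.filter bad).card ≤ (2 * δ ^ 2 + e') * q ^ (3 * n)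
  rw [hcardB]
  refine hsum.trans ?_
  rw [hUcard]
  have h3 : q ^ (2 * n + 1) * (e' * q ^ (n - 1)) = e' * q ^ (3 * n) := by
    have : 2 * n + 1 + (n - 1) = 3 * n := by omega
    rw [mul_left_comm, ← pow_add, this]
  have h4 : U₀.card * q ^ n ≤ 2 * δ ^ 2 * q ^ (3 * n) := by
    calc U₀.card * q ^ n ≤ 2 * δ ^ 2 * q ^ (2 * n) * q ^ n := Nat.mul_le_mul_right _ hU₀card
      _ = 2 * δ ^ 2 * q ^ (3 * n) := by
          rw [mul_assoc, ← pow_add, show 2 * n + n = 3 * n by ring]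
  rw [h3, add_mul]
  exact add_le_add h4 le_rfl

end Count

end Literature.NumberTheory.DiophantineGeometry

end
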